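import Literature.Analysis.FunctionSpaces.LatticePairing
import Literature.Analysis.FunctionSpaces.LatticeDiffOpComp
import HarnessLib

/-!
# The formal adjoint of a periodic operator of order `≤ 2` on the lattice (Warner 6.24 (5), 6.31 (2))

Continuation of `LatticePairing.lean` and `LatticeDiffOp.lean`. For `L` in the normal form
`Lattice.POp` (`L u = ∑ A_{ij}∂_i∂_j u + ∑ b_{ij} ⋆ ∂_i∂_j u + ∑ c_j ⋆ ∂_j u + c₀ ⋆ u`) the
**formal adjoint** acts on a (rapidly decreasing) family `v` by moving every coefficient to the
other side of the derivatives and taking pointwise adjoints (F. W. Warner, GTM 94 (1983), 6.24 (3):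
`L*_{ij} = ∑ D^α ā^α_{ji}`):

  `L† v = ∑_{ij} ∂_j∂_i (A_{ij}† v) + ∑_{ij} ∂_j∂_i (b_{ij}† ⋆ v) - ∑_j ∂_j (c_j† ⋆ v) + c₀† ⋆ v`

(`Lattice.POp.adjAction`, with the adjoint symbols `a†(k) = a(-k)†` of `LatticePairing.lean`), and

  `⟨L u, v⟩ = ⟨u, L† v⟩`  for tempered `u` (`u ∈ H_{-∞}`) and rapidly decreasing `v`

(`Lattice.POp.pairing_apply_left`) — Warner's 6.24 (5) `⟨Lφ, ψ⟩ = ⟨φ, L*ψ⟩` together with its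
extension 6.31 (2) to `u ∈ H_s` ("`⟨L̃u, φ⟩₀ = ⟨u, L*φ⟩₀`"; on the lattice no density argument is
needed since every pairing of a tempered with a rapidly decreasing family converges absolutely).
The proof is the termwise computation from the three elementary adjunctions
`⟨a ⋆ u, v⟩ = ⟨u, a† ⋆ v⟩` (`Lattice.pairing_conv_left`), `⟨∂_j u, v⟩ = -⟨u, ∂_j v⟩`
(`Lattice.pairing_freqDeriv_left`) and `⟨T u, v⟩ = ⟨u, T† v⟩` for a constant map `T`.

## References

* F. W. Warner, *Foundations of Differentiable Manifolds and Lie Groups*, GTM 94 (1983), 6.24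
  (3)–(5), 6.31 (2). [WarnerGTM94]
-/

open Filter Finset
open scoped ENNReal NNReal Topology InnerProductSpace ComplexConjugate

noncomputable section

namespace Literature.Analysis.FunctionSpaces

namespace Lattice

open Torus

variable {d : Type*} [Fintype d]
variable {V W : Type*} [NormedAddCommGroup V] [InnerProductSpace ℂ V] [NormedAddCommGroup W]
  [InnerProductSpace ℂ W]

/-! ### Rapid decrease of the building blocks -/

/-- A rapidly decreasing family convolved with a rapidly decreasing symbol is rapidly decreasing
(it lies in every `H_m`); dot notation on the family: `hc.conv_right ha : RapidDecay (conv a c)`.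
[folklore] -/
theorem _root_.Literature.Analysis.FunctionSpaces.Torus.RapidDecay.conv_right [CompleteSpace W]
    {c : (d → ℤ) → V} (hc : RapidDecay c) {a : (d → ℤ) → (V →L[ℂ] W)} (ha : RapidDecay a) :
    RapidDecay (conv a c) :=
  rapidDecay_of_forall_eNormSq_lt_top fun m => eNormSq_conv_lt_top ha (eNormSq_lt_top_of_rapidDecay hc m)

/-- A constant continuous linear map applied to a rapidly decreasing family. [folklore] -/
theorem _root_.Literature.Analysis.FunctionSpaces.Torus.RapidDecay.comp_apply (T : V →L[ℂ] W)
    {c : (d → ℤ) → V} (hc : RapidDecay c) : RapidDecay fun k => T (c k) :=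
  hc.of_norm_le_mul' (C := ‖T‖) fun k => T.le_opNorm (c k)

/-- Derivatives `∂_j` of rapidly decreasing (vector-valued) families are rapidly decreasing
(`LatticeConvolutionAlgebra`'s `RapidDecay.freqDeriv` is the symbol-valued case). [folklore] -/
theorem _root_.Literature.Analysis.FunctionSpaces.Torus.RapidDecay.freqDeriv' {c : (d → ℤ) → V}
    (hc : RapidDecay c) (j : d) : RapidDecay (freqDeriv j c) :=
  hc.deriv j

/-- Negatives of rapidly decreasing families. [folklore] -/
theorem _root_.Literature.Analysis.FunctionSpaces.Torus.RapidDecay.neg' {c : (d → ℤ) → V}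
    (hc : RapidDecay c) : RapidDecay (-c) := by
  simpa using hc.const_smul (-1)

/-- Differences of rapidly decreasing families. [folklore] -/
theorem _root_.Literature.Analysis.FunctionSpaces.Torus.RapidDecay.sub' {c c' : (d → ℤ) → V}
    (hc : RapidDecay c) (hc' : RapidDecay c') : RapidDecay (c - c') := by
  rw [sub_eq_add_neg]; exact hc.add hc'.neg'

/-! ### Pairing bookkeeping: tempered against rapidly decreasing -/

omit [Fintype d] in
/-- `⟨0, v⟩ = 0`. [folklore] -/
@[simp] theorem pairing_zero_left (v : (d → ℤ) → V) : pairing (0 : (d → ℤ) → V) v = 0 := by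
  simp [pairing]

omit [Fintype d] in
/-- `⟨u, 0⟩ = 0`. [folklore] -/
@[simp] theorem pairing_zero_right (u : (d → ℤ) → V) : pairing u (0 : (d → ℤ) → V) = 0 := by
  simp [pairing]

omit [Fintype d] in
/-- `⟨u, -v⟩ = -⟨u, v⟩` (unconditionally). [folklore] -/
theorem pairing_neg_right (u v : (d → ℤ) → V) : pairing u (-v) = -pairing u v := by
  rw [pairing, pairing, ← tsum_neg]
  exact tsum_congr fun k => by rw [Pi.neg_apply, inner_neg_right]

omit [Fintype d] in
/-- `⟨-u, v⟩ = -⟨u, v⟩` (unconditionally). [folklore] -/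
theorem pairing_neg_left (u v : (d → ℤ) → V) : pairing (-u) v = -pairing u v := by
  rw [pairing, pairing, ← tsum_neg]
  exact tsum_congr fun k => by rw [Pi.neg_apply, inner_neg_left]

/-- Additivity in the left slot (tempered against rapidly decreasing). [folklore] -/
theorem pairing_add_left' {u u' : (d → ℤ) → V} (hu : Tempered u) (hu' : Tempered u')
    {v : (d → ℤ) → V} (hv : RapidDecay v) : pairing (u + u') v = pairing u v + pairing u' v :=
  pairing_add_left (summable_inner_of_tempered_rapidDecay hu hv)
    (summable_inner_of_tempered_rapidDecay hu' hv)

/-- Additivity in the right slot (tempered against rapidly decreasing). [folklore] -/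
theorem pairing_add_right' {u : (d → ℤ) → V} (hu : Tempered u) {v v' : (d → ℤ) → V}
    (hv : RapidDecay v) (hv' : RapidDecay v') : pairing u (v + v') = pairing u v + pairing u v' :=
  pairing_add_right (summable_inner_of_tempered_rapidDecay hu hv)
    (summable_inner_of_tempered_rapidDecay hu hv')

/-- Subtraction in the right slot (tempered against rapidly decreasing). [folklore] -/
theorem pairing_sub_right' {u : (d → ℤ) → V} (hu : Tempered u) {v v' : (d → ℤ) → V}
    (hv : RapidDecay v) (hv' : RapidDecay v') : pairing u (v - v') = pairing u v - pairing u v' :=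
  pairing_sub_right (summable_inner_of_tempered_rapidDecay hu hv)
    (summable_inner_of_tempered_rapidDecay hu hv')

/-- Finite sums in the left slot (tempered against rapidly decreasing). [folklore] -/
theorem pairing_finset_sum_left {ι : Type*} (F : Finset ι) {u : ι → (d → ℤ) → V}
    (hu : ∀ i ∈ F, Tempered (u i)) {v : (d → ℤ) → V} (hv : RapidDecay v) :
    pairing (∑ i ∈ F, u i) v = ∑ i ∈ F, pairing (u i) v := by
  classical
  induction F using Finset.induction_on with
  | empty => simp
  | insert i F hi ih =>
      rw [Finset.sum_insert hi, Finset.sum_insert hi,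
        pairing_add_left' (hu i (Finset.mem_insert_self i F))
          (Tempered.finset_sum F fun k hk => hu k (Finset.mem_insert_of_mem hk)) hv,
        ih fun k hk => hu k (Finset.mem_insert_of_mem hk)]

/-- Finite sums in the right slot (tempered against rapidly decreasing). [folklore] -/
theorem pairing_finset_sum_right {ι : Type*} (F : Finset ι) {u : (d → ℤ) → V} (hu : Tempered u)
    {v : ι → (d → ℤ) → V} (hv : ∀ i ∈ F, RapidDecay (v i)) :
    pairing u (∑ i ∈ F, v i) = ∑ i ∈ F, pairing u (v i) := by
  classical
  induction F using Finset.induction_on with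
  | empty => simp
  | insert i F hi ih =>
      rw [Finset.sum_insert hi, Finset.sum_insert hi,
        pairing_add_right' hu (hv i (Finset.mem_insert_self i F))
          (RapidDecay.finset_sum F fun k hk => hv k (Finset.mem_insert_of_mem hk)),
        ih fun k hk => hv k (Finset.mem_insert_of_mem hk)]

/-- Transport of a double-sum identity through the pairing: if `⟨P_{ij}, v⟩ = ⟨u, Q_{ij}⟩` termwise
then `⟨∑ P_{ij}, v⟩ = ⟨u, ∑ Q_{ij}⟩`. [folklore] -/
theorem pairing_sum_sum_eq {u : (d → ℤ) → V} (hu : Tempered u) {v : (d → ℤ) → W} (hv : RapidDecay v)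
    {P : d → d → (d → ℤ) → W} {Q : d → d → (d → ℤ) → V} (hP : ∀ i j, Tempered (P i j))
    (hQ : ∀ i j, RapidDecay (Q i j)) (h : ∀ i j, pairing (P i j) v = pairing u (Q i j)) :
    pairing (∑ i, ∑ j, P i j) v = pairing u (∑ i, ∑ j, Q i j) := by
  rw [pairing_finset_sum_left _ (fun i _ => Tempered.finset_sum _ fun j _ => hP i j) hv,
    pairing_finset_sum_right _ hu (fun i _ => RapidDecay.finset_sum _ fun j _ => hQ i j)]
  refine Finset.sum_congr rfl fun i _ => ?_
  rw [pairing_finset_sum_left _ (fun j _ => hP i j) hv, pairing_finset_sum_right _ hu (fun j _ => hQ i j)]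
  exact Finset.sum_congr rfl fun j _ => h i j

/-- Transport of a single-sum identity through the pairing. [folklore] -/
theorem pairing_sum_eq {u : (d → ℤ) → V} (hu : Tempered u) {v : (d → ℤ) → W} (hv : RapidDecay v)
    {P : d → (d → ℤ) → W} {Q : d → (d → ℤ) → V} (hP : ∀ j, Tempered (P j)) (hQ : ∀ j, RapidDecay (Q j))
    (h : ∀ j, pairing (P j) v = pairing u (Q j)) :
    pairing (∑ j, P j) v = pairing u (∑ j, Q j) := by
  rw [pairing_finset_sum_left _ (fun j _ => hP j) hv, pairing_finset_sum_right _ hu (fun j _ => hQ j)]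
  exact Finset.sum_congr rfl fun j _ => h j

/-! ### The three elementary adjunctions and their composites -/

section Elementary

variable [CompleteSpace V] [CompleteSpace W]

omit [Fintype d] in
/-- **A constant map moves across as its adjoint**: `⟨T u, v⟩ = ⟨u, T† v⟩` (termwise,
unconditionally). [folklore] -/
theorem pairing_comp_left (T : V →L[ℂ] W) (u : (d → ℤ) → V) (v : (d → ℤ) → W) :
    pairing (fun k => T (u k)) v = pairing u fun k => ContinuousLinearMap.adjoint T (v k) := by
  unfold pairing
  exact tsum_congr fun k => (ContinuousLinearMap.adjoint_inner_right T (u k) (v k)).symm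

/-- `⟨a ⋆ u, v⟩ = ⟨u, a† ⋆ v⟩` for tempered `u` and rapidly decreasing `v`.
[cite: WarnerGTM94, 6.24 (5)] -/
theorem pairing_conv_left' {a : (d → ℤ) → (V →L[ℂ] W)} (ha : RapidDecay a) {u : (d → ℤ) → V}
    (hu : Tempered u) {v : (d → ℤ) → W} (hv : RapidDecay v) :
    pairing (conv a u) v = pairing u (conv (adjSymb a) v) := by
  obtain ⟨s, hs⟩ := hu
  exact pairing_conv_left ha hs (eNormSq_lt_top_of_rapidDecay hv (-s))

omit [Fintype d] in
/-- The frozen part: `⟨T ∂_i∂_j u, v⟩ = ⟨u, ∂_j∂_i (T† v)⟩`. [folklore] -/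
theorem pairing_comp_freqDeriv_freqDeriv_left (T : V →L[ℂ] W) (i j : d) (u : (d → ℤ) → V)
    (v : (d → ℤ) → W) :
    pairing (fun k => T (freqDeriv i (freqDeriv j u) k)) v =
      pairing u (freqDeriv j (freqDeriv i fun k => ContinuousLinearMap.adjoint T (v k))) := by
  rw [pairing_comp_left, pairing_freqDeriv_left, pairing_freqDeriv_left, neg_neg]

/-- The principal perturbation: `⟨b ⋆ ∂_i∂_j u, v⟩ = ⟨u, ∂_j∂_i (b† ⋆ v)⟩`. [cite: WarnerGTM94, 6.24 (5)] -/
theorem pairing_conv_freqDeriv_freqDeriv_left {b : (d → ℤ) → (V →L[ℂ] W)} (hb : RapidDecay b)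
    (i j : d) {u : (d → ℤ) → V} (hu : Tempered u) {v : (d → ℤ) → W} (hv : RapidDecay v) :
    pairing (conv b (freqDeriv i (freqDeriv j u))) v =
      pairing u (freqDeriv j (freqDeriv i (conv (adjSymb b) v))) := by
  rw [pairing_conv_left' hb (hu.freqDeriv_freqDeriv i j) hv, pairing_freqDeriv_left,
    pairing_freqDeriv_left, neg_neg]

/-- First order: `⟨c ⋆ ∂_j u, v⟩ = ⟨u, -∂_j (c† ⋆ v)⟩`. [cite: WarnerGTM94, 6.24 (5)] -/
theorem pairing_conv_freqDeriv_left {c : (d → ℤ) → (V →L[ℂ] W)} (hc : RapidDecay c) (j : d)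
    {u : (d → ℤ) → V} (hu : Tempered u) {v : (d → ℤ) → W} (hv : RapidDecay v) :
    pairing (conv c (freqDeriv j u)) v = pairing u (-freqDeriv j (conv (adjSymb c) v)) := by
  rw [pairing_conv_left' hc (hu.freqDeriv j) hv, pairing_freqDeriv_left, pairing_neg_right]

end Elementary

/-! ### The formal adjoint and the adjunction identity -/

namespace POp

variable [CompleteSpace V] [CompleteSpace W] (L : POp d V W)

/-- **The formal adjoint** `L†` of a periodic operator of order `≤ 2`, as an action on families:
`L† v = ∑_{ij} ∂_j∂_i (A_{ij}† v) + ∑_{ij} ∂_j∂_i (b_{ij}† ⋆ v) - ∑_j ∂_j (c_j† ⋆ v) + c₀† ⋆ v`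
(Warner 6.24 (3): `L*_{ij} = ∑_α D^α ā^α_{ji}`). [cite: WarnerGTM94, 6.24 (3)] -/
def adjAction (v : (d → ℤ) → W) : (d → ℤ) → V :=
  ∑ i, ∑ j, freqDeriv j (freqDeriv i fun k => ContinuousLinearMap.adjoint (L.A i j) (v k)) +
    ∑ i, ∑ j, freqDeriv j (freqDeriv i (conv (adjSymb (L.b i j)) v)) -
    ∑ j, freqDeriv j (conv (adjSymb (L.c1 j)) v) + conv (adjSymb L.c0) v

/-- Unfolding of `adjAction` (use this rather than definitional unfolding). [folklore] -/
theorem adjAction_def (v : (d → ℤ) → W) : L.adjAction v =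
    ∑ i, ∑ j, freqDeriv j (freqDeriv i fun k => ContinuousLinearMap.adjoint (L.A i j) (v k)) +
    ∑ i, ∑ j, freqDeriv j (freqDeriv i (conv (adjSymb (L.b i j)) v)) -
    ∑ j, freqDeriv j (conv (adjSymb (L.c1 j)) v) + conv (adjSymb L.c0) v := by
  unfold adjAction
  rfl

/-- `L† v` is rapidly decreasing for rapidly decreasing `v` (so it is again a test family:
Warner's "`L*φ ∈ C_0^∞(V) ⊂ 𝒫`"). [cite: WarnerGTM94, 6.31] -/
theorem _root_.Literature.Analysis.FunctionSpaces.Torus.RapidDecay.adjAction {v : (d → ℤ) → W}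
    (hv : RapidDecay v) : RapidDecay (L.adjAction v) := by
  rw [adjAction_def, sub_eq_add_neg]
  refine (((RapidDecay.finset_sum _ fun i _ => RapidDecay.finset_sum _ fun j _ => ?_).add
    (RapidDecay.finset_sum _ fun i _ => RapidDecay.finset_sum _ fun j _ => ?_)).add
    (RapidDecay.finset_sum _ fun j _ => ?_).neg').add (hv.conv_right L.hc0.adjSymb)
  · exact ((hv.comp_apply _).freqDeriv' i).freqDeriv' j
  · exact ((hv.conv_right (L.hb i j).adjSymb).freqDeriv' i).freqDeriv' j
  · exact (hv.conv_right (L.hc1 j).adjSymb).freqDeriv' j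

/-- **`⟨L u, v⟩ = ⟨u, L† v⟩` for tempered `u` and rapidly decreasing `v`** (Warner 6.24 (5),
"`⟨Lφ, ψ⟩ = ⟨φ, L*ψ⟩`", and 6.31 (2), "`⟨L̃u, φ⟩₀ = ⟨u, L*φ⟩₀` for `u ∈ H_s`"). Termwise from the
three elementary adjunctions. [cite: WarnerGTM94, 6.24 (5)] -/
theorem pairing_apply_left {u : (d → ℤ) → V} (hu : Tempered u) {v : (d → ℤ) → W} (hv : RapidDecay v) :
    pairing (L.apply u) v = pairing u (L.adjAction v) := by
  -- the pieces of `L u` are tempered, those of `L† v` rapidly decreasing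
  have hu2 : ∀ i j, Tempered (freqDeriv i (freqDeriv j u)) := fun i j => hu.freqDeriv_freqDeriv i j
  have tA : ∀ i j, Tempered (fun k => L.A i j (freqDeriv i (freqDeriv j u) k)) := fun i j =>
    (hu2 i j).comp_apply _
  have tB : ∀ i j, Tempered (conv (L.b i j) (freqDeriv i (freqDeriv j u))) := fun i j =>
    (hu2 i j).conv (L.hb i j)
  have tC : ∀ j, Tempered (conv (L.c1 j) (freqDeriv j u)) := fun j => (hu.freqDeriv j).conv (L.hc1 j)
  have tD : Tempered (conv L.c0 u) := hu.conv L.hc0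
  have rA : ∀ i j, RapidDecay (freqDeriv j (freqDeriv i fun k => ContinuousLinearMap.adjoint (L.A i j) (v k))) :=
    fun i j => ((hv.comp_apply _).freqDeriv' i).freqDeriv' j
  have rB : ∀ i j, RapidDecay (freqDeriv j (freqDeriv i (conv (adjSymb (L.b i j)) v))) := fun i j =>
    ((hv.conv_right (L.hb i j).adjSymb).freqDeriv' i).freqDeriv' j
  have rC' : ∀ j, RapidDecay (freqDeriv j (conv (adjSymb (L.c1 j)) v)) := fun j =>
    (hv.conv_right (L.hc1 j).adjSymb).freqDeriv' j
  have rD : RapidDecay (conv (adjSymb L.c0) v) := hv.conv_right L.hc0.adjSymb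
  -- the four groups
  have hP : L.principal u = ∑ i, ∑ j, fun k => L.A i j (freqDeriv i (freqDeriv j u) k) := by
    funext k; simp [principal, Finset.sum_apply]
  have gA : pairing (L.principal u) v =
      pairing u (∑ i, ∑ j, freqDeriv j (freqDeriv i fun k => ContinuousLinearMap.adjoint (L.A i j) (v k))) := by
    rw [hP]
    exact pairing_sum_sum_eq hu hv tA rA fun i j => pairing_comp_freqDeriv_freqDeriv_left _ i j u v
  have gB : pairing (∑ i, ∑ j, conv (L.b i j) (freqDeriv i (freqDeriv j u))) v =
      pairing u (∑ i, ∑ j, freqDeriv j (freqDeriv i (conv (adjSymb (L.b i j)) v))) :=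
    pairing_sum_sum_eq hu hv tB rB fun i j => pairing_conv_freqDeriv_freqDeriv_left (L.hb i j) i j hu hv
  have gC : pairing (∑ j, conv (L.c1 j) (freqDeriv j u)) v =
      -pairing u (∑ j, freqDeriv j (conv (adjSymb (L.c1 j)) v)) := by
    rw [pairing_sum_eq hu hv tC (fun j => (rC' j).neg') fun j => pairing_conv_freqDeriv_left (L.hc1 j) j hu hv,
      ← pairing_neg_right, ← Finset.sum_neg_distrib]
  have gD : pairing (conv L.c0 u) v = pairing u (conv (adjSymb L.c0) v) := pairing_conv_left' L.hc0 hu hv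
  -- assemble
  have tP : Tempered (L.principal u) := L.tempered_principal hu
  have tBs : Tempered (∑ i, ∑ j, conv (L.b i j) (freqDeriv i (freqDeriv j u))) :=
    Tempered.finset_sum _ fun i _ => Tempered.finset_sum _ fun j _ => tB i j
  have tCs : Tempered (∑ j, conv (L.c1 j) (freqDeriv j u)) := Tempered.finset_sum _ fun j _ => tC j
  have rAs : RapidDecay (∑ i, ∑ j, freqDeriv j (freqDeriv i fun k => ContinuousLinearMap.adjoint (L.A i j) (v k))) :=
    RapidDecay.finset_sum _ fun i _ => RapidDecay.finset_sum _ fun j _ => rA i j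
  have rBs : RapidDecay (∑ i, ∑ j, freqDeriv j (freqDeriv i (conv (adjSymb (L.b i j)) v))) :=
    RapidDecay.finset_sum _ fun i _ => RapidDecay.finset_sum _ fun j _ => rB i j
  have rCs : RapidDecay (∑ j, freqDeriv j (conv (adjSymb (L.c1 j)) v)) :=
    RapidDecay.finset_sum _ fun j _ => rC' j
  rw [apply_def, lower_def, pairing_add_left' tP ((tBs.add tCs).add tD) hv,
    pairing_add_left' (tBs.add tCs) tD hv, pairing_add_left' tBs tCs hv, gA, gB, gC, gD,
    adjAction_def, pairing_add_right' hu ((rAs.add rBs).sub' rCs) rD,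
    pairing_sub_right' hu (rAs.add rBs) rCs, pairing_add_right' hu rAs rBs]
  ring

end POp

end Lattice

end Literature.Analysis.FunctionSpaces
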